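import Summits.KontsevichZagierPeriods.KontsevichZagierPeriods.Theorems.SoloInformedHypSubst
import HarnessLib
import HarnessLib.Audit

/-!
# SoloInformed — the period conjecture for integrands rational in `(x, √(x² − 1))`, `x ≥ 1`

Solo programme `solo-KontsevichZagierPeriods-informed`, session s112, file 27.

Instance of the one-move substitution lemma (file 26): `Φ(t) = (t² + 1)/(2t)` on `t ≥ 1`, a
bijection onto `[1, ∞)` with inverse `τ(x) = x + √(x² − 1)` and `|Φ'(t)| = (t² − 1)/(2t²)`.
Functions rational in `(x, √(x² − 1))` with real algebraic coefficients are `P(τ(x))/Q(τ(x))`,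
`P, Q ∈ K[X]` (`x = (τ² + 1)/(2τ)`, `√(x² − 1) = (τ² − 1)/(2τ)`): the class
`SoloInformedIsKHypTwoOne` (`D ⊆ [1, ∞)` `ℚ`-semialgebraic).  After the substitution the integrand
is `K`-rational, hence (`soloInformed_kzp_isKHypTwoOne`) **the Kontsevich–Zagier period conjecture
holds between any two absolutely convergent integrals of functions rational in `(x, √(x² − 1))`
with real algebraic coefficients over `D, D' ⊆ [1, ∞)`, and between these and the classes of files
18, 24–26 and rational representations of dimension `≤ 1`, whenever the values agree**
(e.g. `∫₁² dx/√(x² − 1) = log(2 + √3)`).  Together with files 25–26 this covers the three real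
forms `√(1 − x²)`, `√(1 + x²)`, `√(x² − 1)` of a quadratic radical (genus `0`).

References: M. Kontsevich, D. Zagier, *Periods* (2001), §1.1–1.2; A. Baker (1975), Thm. 2.1.
-/

noncomputable section

open scoped BigOperators Polynomial

namespace Summit.KontsevichZagierPeriods.KontsevichZagierPeriods.Theorems

open Set MeasureTheory
open Literature.ModelTheory.ExponentialFields
open Literature.NumberTheory.Transcendental Literature.NumberTheory.Transcendental.KZ

/-- `Φ(t) = (t² + 1)/(2t)`. -/
def soloInformedHypTwoMap (w : Fin 1 → ℝ) : Fin 1 → ℝ := fun _ => (w 0 * w 0 + 1) / (2 * w 0)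

/-- `Φ'(t) = ((t² − 1)/(2t²)) • id`. -/
def soloInformedHypTwoDeriv (w : Fin 1 → ℝ) : (Fin 1 → ℝ) →L[ℝ] (Fin 1 → ℝ) :=
  ((w 0 * w 0 - 1) / (2 * (w 0 * w 0))) • ContinuousLinearMap.id ℝ (Fin 1 → ℝ)

/-- `τ(x) = x + √(x² − 1)`, the inverse of `Φ` (`[1, ∞) → [1, ∞)`). -/
def soloInformedHypTwoInv (x : ℝ) : ℝ := x + Real.sqrt (x ^ 2 - 1)

/-- Pointwise formula. -/
@[simp] theorem soloInformed_hypTwoMap_apply (w : Fin 1 → ℝ) (i : Fin 1) :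
    soloInformedHypTwoMap w i = (w 0 * w 0 + 1) / (2 * w 0) := rfl

/-- The scalar derivative of `s ↦ (s² + 1)/(2s)` at `s ≠ 0`. -/
theorem soloInformed_hasDerivAt_hypTwo {s : ℝ} (hs : s ≠ 0) :
    HasDerivAt (fun y : ℝ => (y * y + 1) / (2 * y)) ((s * s - 1) / (2 * (s * s))) s := by
  have hsq : HasDerivAt (fun y : ℝ => y * y) (1 * s + s * 1) s := (hasDerivAt_id s).mul (hasDerivAt_id s)
  have hc : HasDerivAt (fun y : ℝ => y * y + 1) (1 * s + s * 1 + 0) s := hsq.add (hasDerivAt_const s 1)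
  have hd : HasDerivAt (fun y : ℝ => 2 * y) (2 * 1) s := (hasDerivAt_id s).const_mul 2
  refine (hc.div hd (by positivity)).congr_deriv ?_
  field_simp
  ring

/-- `Φ` is differentiable at `t ≠ 0` with the stated derivative. -/
theorem soloInformed_hasFDerivAt_hypTwoMap {w : Fin 1 → ℝ} (hw : w 0 ≠ 0) :
    HasFDerivAt soloInformedHypTwoMap (soloInformedHypTwoDeriv w) w := by
  rw [hasFDerivAt_pi']
  intro i
  have h1 : HasFDerivAt (fun w : Fin 1 → ℝ => w 0)
      (ContinuousLinearMap.proj (R := ℝ) (φ := fun _ : Fin 1 => ℝ) 0) w :=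
    (ContinuousLinearMap.proj (R := ℝ) (φ := fun _ : Fin 1 => ℝ) 0).hasFDerivAt
  have h2 := (soloInformed_hasDerivAt_hypTwo hw).comp_hasFDerivAt w h1
  refine h2.congr_fderiv ?_
  ext v
  simp [soloInformedHypTwoDeriv, Fin.fin_one_eq_zero i]

/-- The Jacobian determinant of `Φ`. -/
theorem soloInformed_det_hypTwoDeriv (w : Fin 1 → ℝ) :
    (soloInformedHypTwoDeriv w).det = (w 0 * w 0 - 1) / (2 * (w 0 * w 0)) := by
  unfold soloInformedHypTwoDeriv
  rw [ContinuousLinearMap.det, ContinuousLinearMap.toLinearMap_smul, ContinuousLinearMap.coe_id,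
    LinearMap.det_smul, LinearMap.det_id, Module.finrank_fin_fun]
  simp

/-- `|det Φ'(t)| = (t² − 1)/(2t²)` for `t ≥ 1`. -/
theorem soloInformed_abs_det_hypTwoDeriv {w : Fin 1 → ℝ} (hw : 1 ≤ w 0) :
    |(soloInformedHypTwoDeriv w).det| = (w 0 * w 0 - 1) / (2 * (w 0 * w 0)) := by
  rw [soloInformed_det_hypTwoDeriv]
  exact abs_of_nonneg (div_nonneg (by nlinarith) (mul_nonneg zero_le_two (mul_self_nonneg _)))

/-- `Φ` is `ℚ`-semialgebraic on every `ℚ`-semialgebraic subset of `{t ≠ 0}`. -/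
theorem soloInformed_isSemialgebraicMapOn_hypTwoMap {s : Set (Fin 1 → ℝ)} (hs : IsSemialgebraic ℚ s)
    (hs0 : ∀ w ∈ s, w 0 ≠ 0) : IsSemialgebraicMapOn ℚ s soloInformedHypTwoMap := by
  refine IsSemialgebraicMapOn.of_forall hs fun i => ?_
  refine (isSemialgebraicFunOn_aeval_div_aeval hs (MvPolynomial.X 0 ^ 2 + 1 : MvPolynomial (Fin 1) ℚ)
    (MvPolynomial.C (2 : ℚ) * MvPolynomial.X 0) fun v hv => ?_).congr fun v _ => ?_
  · simp only [map_mul, MvPolynomial.aeval_C, MvPolynomial.aeval_X, eq_ratCast, Rat.cast_ofNat]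
    exact mul_ne_zero two_ne_zero (hs0 v hv)
  · show (MvPolynomial.aeval v (MvPolynomial.X 0 ^ 2 + 1 : MvPolynomial (Fin 1) ℚ) : ℝ) /
        MvPolynomial.aeval v (MvPolynomial.C (2 : ℚ) * MvPolynomial.X 0 : MvPolynomial (Fin 1) ℚ) =
      soloInformedHypTwoMap v i
    simp [soloInformedHypTwoMap, pow_two]

/-- `|det Φ'|` is `ℚ`-semialgebraic on every `ℚ`-semialgebraic subset of `{t ≥ 1}`. -/
theorem soloInformed_isSemialgebraicFunOn_abs_det_hypTwoDeriv {s : Set (Fin 1 → ℝ)}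
    (hs : IsSemialgebraic ℚ s) (hs1 : ∀ w ∈ s, 1 ≤ w 0) :
    IsSemialgebraicFunOn ℚ s fun t => |(soloInformedHypTwoDeriv t).det| := by
  refine (isSemialgebraicFunOn_aeval_div_aeval hs (MvPolynomial.X 0 ^ 2 - 1 : MvPolynomial (Fin 1) ℚ)
    (MvPolynomial.C (2 : ℚ) * MvPolynomial.X 0 ^ 2) fun v hv => ?_).congr fun v hv => ?_
  · simp only [map_mul, map_pow, MvPolynomial.aeval_C, MvPolynomial.aeval_X, eq_ratCast, Rat.cast_ofNat]
    exact mul_ne_zero two_ne_zero (pow_ne_zero _ (by have := hs1 v hv; positivity))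
  · show (MvPolynomial.aeval v (MvPolynomial.X 0 ^ 2 - 1 : MvPolynomial (Fin 1) ℚ) : ℝ) /
        MvPolynomial.aeval v (MvPolynomial.C (2 : ℚ) * MvPolynomial.X 0 ^ 2 : MvPolynomial (Fin 1) ℚ) =
      |(soloInformedHypTwoDeriv v).det|
    rw [soloInformed_abs_det_hypTwoDeriv (hs1 v hv)]
    simp [pow_two]

/-- `Φ` is injective on `{t | 1 ≤ t 0}`. -/
theorem soloInformed_injOn_hypTwoMap : InjOn soloInformedHypTwoMap {t : Fin 1 → ℝ | 1 ≤ t 0} := by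
  intro a ha b hb h
  have ha0 : 1 ≤ a 0 := ha
  have hb0 : 1 ≤ b 0 := hb
  have h0 : (a 0 * a 0 + 1) / (2 * a 0) = (b 0 * b 0 + 1) / (2 * b 0) := congr_fun h 0
  rw [div_eq_div_iff (by positivity) (by positivity)] at h0
  have hab : a 0 = b 0 := by
    have h1 : (a 0 - b 0) * (a 0 * b 0 - 1) = 0 := by nlinarith [h0]
    rcases mul_eq_zero.1 h1 with h | h
    · linarith
    · -- `a b = 1` with `a, b ≥ 1` forces `a = b = 1`
      have hab1 : a 0 * b 0 = 1 := by linarith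
      nlinarith [mul_le_mul ha0 hb0 zero_le_one (le_trans zero_le_one ha0)]
  rw [KZ.eq_const_apply_zero a, KZ.eq_const_apply_zero b, hab]

/-- For `x ≥ 1`: `τ(x) ≥ 1` and `Φ(τ(x)) = x`. -/
theorem soloInformed_hypTwoMap_hypTwoInv {x : ℝ} (hx : 1 ≤ x) :
    1 ≤ soloInformedHypTwoInv x ∧
      (soloInformedHypTwoInv x * soloInformedHypTwoInv x + 1) / (2 * soloInformedHypTwoInv x) = x := by
  have hsq : Real.sqrt (x ^ 2 - 1) * Real.sqrt (x ^ 2 - 1) = x ^ 2 - 1 :=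
    Real.mul_self_sqrt (by nlinarith)
  have hge : 1 ≤ soloInformedHypTwoInv x := by
    unfold soloInformedHypTwoInv
    have := Real.sqrt_nonneg (x ^ 2 - 1)
    linarith
  refine ⟨hge, ?_⟩
  rw [div_eq_iff (by positivity)]
  unfold soloInformedHypTwoInv at *
  nlinarith [hsq]

/-- For `t ≥ 1`: `τ(Φ(t)) = t`. -/
theorem soloInformed_hypTwoInv_hypTwoMap {t : ℝ} (ht : 1 ≤ t) :
    soloInformedHypTwoInv ((t * t + 1) / (2 * t)) = t := by
  unfold soloInformedHypTwoInv
  have ht0 : t ≠ 0 := by positivity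
  have h1 : ((t * t + 1) / (2 * t)) ^ 2 - 1 = ((t * t - 1) / (2 * t)) ^ 2 := by
    field_simp
    ring
  rw [h1, Real.sqrt_sq (div_nonneg (by nlinarith) (by positivity))]
  field_simp
  ring

/-! ## The class of integrands rational in `(x, √(x² − 1))`, `x ≥ 1` -/

/-- `r = [D, f]` of dimension `1` has `D ⊆ [1, ∞)` and integrand `P(τ(x))/Q(τ(x))` on `D`,
`τ(x) = x + √(x² − 1)`, for some `P, Q ∈ K[X]` with `Q(τ(x)) ≠ 0` on `D`. -/
def SoloInformedIsKHypTwoOne (r : IntegralRep 1) : Prop :=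
  ∃ P Q : (algebraicClosure ℚ ℝ)[X],
    (∀ x ∈ r.domain, 1 ≤ x 0 ∧ (Polynomial.aeval (soloInformedHypTwoInv (x 0)) Q : ℝ) ≠ 0) ∧
    EqOn r.integrand (fun x => (Polynomial.aeval (soloInformedHypTwoInv (x 0)) P : ℝ) /
      Polynomial.aeval (soloInformedHypTwoInv (x 0)) Q) r.domain

/-- **Members of the class lie in the span of points and segments.** -/
theorem soloInformed_segSpan_of_isKHypTwoOne (r : IntegralRep 1) (hr : SoloInformedIsKHypTwoOne r) :
    of r ∈ soloInformedSegSpan := by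
  obtain ⟨P, Q, hq, hpq⟩ := hr
  have hS₀ : IsSemialgebraic ℚ {t : Fin 1 → ℝ | 1 ≤ t 0} := by
    have h := (isSemialgebraicFunOn_aeval (isSemialgebraic_univ : IsSemialgebraic ℚ (univ : Set (Fin 1 → ℝ)))
      (MvPolynomial.X 0 - 1 : MvPolynomial (Fin 1) ℚ)).isSemialgebraic_sep_nonneg
    convert h using 1
    ext t; simp [sub_nonneg]
  have hne : ∀ w ∈ {t : Fin 1 → ℝ | 1 ≤ t 0}, w 0 ≠ 0 := fun w hw => by
    have : (1 : ℝ) ≤ w 0 := hw; positivity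
  have hge : ∀ w ∈ {t : Fin 1 → ℝ | 1 ≤ t 0}, 1 ≤ w 0 := fun w hw => hw
  obtain ⟨R', hdom, hint, hrel⟩ := soloInformed_exists_subst soloInformedHypTwoMap soloInformedHypTwoDeriv
    (soloInformed_isSemialgebraicMapOn_hypTwoMap hS₀ hne)
    (fun t ht => soloInformed_hasFDerivAt_hypTwoMap (hne t ht)) soloInformed_injOn_hypTwoMap
    (soloInformed_isSemialgebraicFunOn_abs_det_hypTwoDeriv hS₀ hge) r fun x hx =>
      ⟨fun _ => soloInformedHypTwoInv (x 0), (soloInformed_hypTwoMap_hypTwoInv (hq x hx).1).1,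
        funext fun i => by
          rw [soloInformed_hypTwoMap_apply, (soloInformed_hypTwoMap_hypTwoInv (hq x hx).1).2,
            Fin.fin_one_eq_zero i]⟩
  refine soloInformed_segSpan_of_subst hrel (soloInformed_segSpan_of_isKRationalOne R' ?_)
  have hmem : ∀ t ∈ R'.domain, 1 ≤ t 0 ∧ soloInformedHypTwoMap t ∈ r.domain := fun t ht => by
    rw [hdom] at ht; exact ht
  have hτ : ∀ t : Fin 1 → ℝ, 1 ≤ t 0 → soloInformedHypTwoInv (soloInformedHypTwoMap t 0) = t 0 :=
    fun t ht => by rw [soloInformed_hypTwoMap_apply]; exact soloInformed_hypTwoInv_hypTwoMap ht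
  refine ⟨P * (Polynomial.X ^ 2 - 1), Q * (Polynomial.C (2 : algebraicClosure ℚ ℝ) * Polynomial.X ^ 2),
    fun t ht => ?_, fun t ht => ?_⟩
  · obtain ⟨ht1, hx⟩ := hmem t ht
    have h := (hq _ hx).2
    rw [hτ t ht1] at h
    rw [map_mul, map_mul, map_pow, Polynomial.aeval_X, Polynomial.aeval_C, map_ofNat]
    exact mul_ne_zero h (by positivity)
  · obtain ⟨ht1, hx⟩ := hmem t ht
    rw [hint]
    show r.integrand (soloInformedHypTwoMap t) * |(soloInformedHypTwoDeriv t).det| = _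
    rw [hpq hx, soloInformed_abs_det_hypTwoDeriv ht1]
    show (Polynomial.aeval (soloInformedHypTwoInv (soloInformedHypTwoMap t 0)) P : ℝ) /
        Polynomial.aeval (soloInformedHypTwoInv (soloInformedHypTwoMap t 0)) Q *
          ((t 0 * t 0 - 1) / (2 * (t 0 * t 0))) =
      (Polynomial.aeval (t 0) (P * (Polynomial.X ^ 2 - 1)) : ℝ) /
        Polynomial.aeval (t 0) (Q * (Polynomial.C (2 : algebraicClosure ℚ ℝ) * Polynomial.X ^ 2))
    have hQ : (Polynomial.aeval (t 0) Q : ℝ) ≠ 0 := by have h := (hq _ hx).2; rwa [hτ t ht1] at h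
    rw [hτ t ht1, map_mul, map_sub, map_one, map_pow, Polynomial.aeval_X, map_mul, map_mul, map_pow,
      Polynomial.aeval_X, Polynomial.aeval_C, map_ofNat]
    have h1 : t 0 ≠ 0 := by positivity
    field_simp

/-- **The Kontsevich–Zagier period conjecture for one-variable integrands rational in
`(x, √(x² − 1))` with real algebraic coefficients on domains `⊆ [1, ∞)`** (unconditional); likewise
against the classes of files 25–26, the `K`-rational class and rational representations of
dimension `≤ 1`. [Kontsevich–Zagier 2001, §1.2 Question 1; this work] -/
theorem soloInformed_kzp_isKHypTwoOne (r r' : IntegralRep 1) (hr : SoloInformedIsKHypTwoOne r)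
    (hr' : SoloInformedIsKHypTwoOne r') :
    (r.value = r'.value → Equivalent r r') ∧
    (∀ r₁ : IntegralRep 1, SoloInformedIsKHypOne r₁ → r.value = r₁.value → Equivalent r r₁) ∧
    (∀ r₁ : IntegralRep 1, SoloInformedIsKCircleOne r₁ → r.value = r₁.value → Equivalent r r₁) ∧
    (∀ r₁ : IntegralRep 1, SoloInformedIsKRationalOne r₁ → r.value = r₁.value → Equivalent r r₁) ∧
    (∀ {n : ℕ} (hn : n ≤ 1) (r₀ : IntegralRep n), r₀.IsRational → r.value = r₀.value →
      Equivalent r r₀) := by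
  have h := soloInformed_segSpan_of_isKHypTwoOne r hr
  exact ⟨fun hv => soloInformed_equivalent_of_mem_segSpan h
      (soloInformed_segSpan_of_isKHypTwoOne r' hr') hv,
    fun r₁ hr₁ hv => soloInformed_equivalent_of_mem_segSpan h
      (soloInformed_segSpan_of_isKHypOne r₁ hr₁) hv,
    fun r₁ hr₁ hv => soloInformed_equivalent_of_mem_segSpan h
      (soloInformed_segSpan_of_isKCircleOne r₁ hr₁) hv,
    fun r₁ hr₁ hv => soloInformed_equivalent_of_mem_segSpan h
      (soloInformed_segSpan_of_isKRationalOne r₁ hr₁) hv,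
    fun hn r₀ hr₀ hv => soloInformed_equivalent_of_mem_segSpan h
      (soloInformed_of_mem_segSpan_of_isRational hn r₀ hr₀) hv⟩

/-- `[D, 1/√(x² − 1)]` (`D ⊆ (1, ∞)`) is in the class (`1/√(x²−1) = 2τ/(τ² − 1)`); e.g.
`∫₁² dx/√(x² − 1) = log(2 + √3)`. -/
theorem soloInformed_isKHypTwoOne_inv_sqrt (r : IntegralRep 1) (hD : ∀ x ∈ r.domain, 1 < x 0)
    (hf : EqOn r.integrand (fun x => (Real.sqrt (x 0 ^ 2 - 1))⁻¹) r.domain) :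
    SoloInformedIsKHypTwoOne r := by
  have key : ∀ x : ℝ, 1 < x → 0 < Real.sqrt (x ^ 2 - 1) ∧
      Real.sqrt (x ^ 2 - 1) * Real.sqrt (x ^ 2 - 1) = x ^ 2 - 1 := fun x hx =>
    ⟨Real.sqrt_pos.2 (by nlinarith), Real.mul_self_sqrt (by nlinarith)⟩
  refine ⟨Polynomial.C (2 : algebraicClosure ℚ ℝ) * Polynomial.X, Polynomial.X ^ 2 - 1,
    fun x hx => ⟨(hD x hx).le, ?_⟩, fun x hx => ?_⟩
  · obtain ⟨hspos, hsq⟩ := key (x 0) (hD x hx)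
    rw [map_sub, map_one, map_pow, Polynomial.aeval_X]
    have hτ : soloInformedHypTwoInv (x 0) = x 0 + Real.sqrt (x 0 ^ 2 - 1) := rfl
    rw [hτ]
    nlinarith [hsq, hD x hx]
  · obtain ⟨hspos, hsq⟩ := key (x 0) (hD x hx)
    rw [hf hx]
    show (Real.sqrt (x 0 ^ 2 - 1))⁻¹ =
      (Polynomial.aeval (soloInformedHypTwoInv (x 0)) (Polynomial.C (2 : algebraicClosure ℚ ℝ) * Polynomial.X) : ℝ) /
        Polynomial.aeval (soloInformedHypTwoInv (x 0)) (Polynomial.X ^ 2 - 1 : (algebraicClosure ℚ ℝ)[X])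
    rw [map_mul, Polynomial.aeval_C, Polynomial.aeval_X, map_sub, map_one, map_pow, Polynomial.aeval_X,
      map_ofNat]
    have hτ : soloInformedHypTwoInv (x 0) = x 0 + Real.sqrt (x 0 ^ 2 - 1) := rfl
    have hden : (x 0 + Real.sqrt (x 0 ^ 2 - 1)) ^ 2 - 1 ≠ 0 := by nlinarith [hsq, hD x hx]
    rw [hτ, eq_div_iff hden, inv_mul_eq_div, div_eq_iff hspos.ne']
    nlinarith [hsq]

end Summit.KontsevichZagierPeriods.KontsevichZagierPeriods.Theorems
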